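import Summits.NavierStokesRegularity.FluidComputer.GateBudgetPulseFine
import HarnessLib

/-!
# GateBudget part 73 — the clock band of a pulse (§220–§223)

Cell `pub-fluidc`, blueprint seat bp1 (gen 36, third item, file 1 of 4); namespace
`Summit.NavierStokesRegularity.FluidComputer.GateBudget`, headline family
`RotorKnob.rotorCircuit K K¹⁰ ε ρ` from `delayInit` (§220–§222 hold for every member).
HONEST FRAMING: a low prior, high value-of-information experiment on Tao's machine paradigm;
NOT a claim that NS blows up.

THE POINT. Parts 70–72 gave the leak FLOOR `Δã ≥ 1/K⁹` per clean misfiring rung. A matching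
CEILING must resolve the pulse in TIME: the output `K∫d²` of a pulse is spent in three very
different regimes — the logarithmically long CLIMB of the trigger from `ρ²/K⁹` (transfer mode
still `≈ d(r)`), the SWING proper (duration `O(1/(θK¹⁰))`, transfer mode `O(1)`), and the FALL
(trigger decaying, transfer mode pinned near `±d(r)`). This file is the clock side of that
decomposition; parts 74–76 (`GateBudgetLeakCeiling` ff.) add the rotor. On a pulse the clock
`(b, c)` runs Tao's pump `b' = εa² - μc²`, `c' = ρ²e^{-M}a² + μbc` (`μ = M/ε`) on the kept ring
`|b² + c² - R_r²| ≤ 10⁻⁶ε²` of part 61 §188: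
* §220 `clock_charge_le`: the clock charges at rate at most `ε`: `b(t) ≤ b(s) + ε(t - s)`.
* §221 `clock_rise_exp`: while `b ≥ β` the trigger grows at least like `e^{μβt}`
  (`log c` climbs at rate `≥ μβ`), so a climb through a trigger ratio `q` lasts `≤ log q/(μβ)`.
* §222 `clock_band_ratio`, THE BAND LAW: on the ring the pump is a logistic inequality
  `b' ≤ -μ(R₂² - b²)` (`R₂² + ε²/M ≤ b² + c²`), so wherever `|b| < R₂` the log-ratio
  `log((R₂ + b)/(R₂ - b))` falls at rate `≥ 2μR₂` — Tao's `tanh` switching profile read on the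
  CLOCK instead of the output (compare part 26 §77 `knob_drain_riccati`).
* §223 `pulse_clock_phases`, THE PHASE DECOMPOSITION of a headline pulse entered at
  `b = θε`, `c = ρ²/K⁹` (`θ ≥ 5/4`) and left with `b ≤ -(31/32)θε`: band times
  `r < t₁ < t₂ ≤ T'` with `b ≥ (31/32)θε` on `[r, t₁]` (CLIMB, duration
  `≤ 32(log c(t₁) - log c(r))/(31θK¹⁰)`), `t₂ - t₁ ≤ 4.16/(θK¹⁰)` (SWING: the band
  `|b| ≤ (31/32)θε` is crossed in `≤ 6 log 2/(μR₂)`, `R₂ = (1 - 10⁻⁶)θε`, ratio `≤ 64`),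
  `b ≤ -(15/16)θε` on `[t₂, T']` (FALL), and `c² ≤ θ²ε²/16` at both band edges.

HONEST LIMITS. (i) Clock only — nothing about the rotor, the output, or the dose phase;
(ii) the band edge `31/32`, the ring slack `10⁻⁶` and `4.16 ≥ 6 log 2/(1 - 10⁻⁶)` are
bookkeeping constants, not optimised; (iii) the FALL is not timed here: after the band the
clock may recharge at rate `ε`, and part 61's exit floor `c(T') ≥ ρ²e^{-485K}/K⁹` does not
time the decay — parts 74/75 do not need it (they spend the fine duration `241 log K/K¹⁰`
of part 65 there); (iv) headline family `M = K¹⁰`, `K ≥ 16`, `K¹⁰ρ² ≤ 2ε` in §223;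
(v) nothing about Navier–Stokes.
[cite: Tao2016AveragedNS, §5.5 Theorem 5.3, (5.5), (b-eq), (c-eq), (energy-con), (tcable)]
-/

noncomputable section

namespace Summit.NavierStokesRegularity.FluidComputer.GateBudget

open Real Set Filter Topology
open Literature.Analysis.FluidPDE.Tao2016AveragedNS

variable {K M ε ρ : ℝ} {X : ℝ → Fin 5 → ℝ}

/-! ## §220 The clock charges at rate at most `ε` -/

/-- §220 (any member from `delayInit`, `ε, M ≥ 0`): `b(t) ≤ b(s) + ε(t - s)` for `s ≤ t`
(`b' = εa² - ε⁻¹Mc² ≤ ε` as `a² ≤ 1`). [cite: Tao2016AveragedNS, §5.5 (b-eq), (est)] -/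
theorem clock_charge_le (hX : ∀ t, HasDerivAt X (RotorKnob.rotorCircuit K M ε ρ (X t)) t)
    (h0 : X 0 = delayInit) (hε : 0 ≤ ε) (hM : 0 ≤ M) {s t : ℝ} (hst : s ≤ t) :
    X t 1 ≤ X s 1 + ε * (t - s) := by
  have hanti := Thm53.antitoneOn_sub_of_deriv_le (f := fun u => X u 1)
    (f' := fun u => ε * X u 0 ^ 2 - ε⁻¹ * M * X u 2 ^ 2) (Φ := fun u => ε * u)
    (φ := fun _ => ε) (convex_Icc s t) (fun u _ => RotorKnob.hasDerivAt_b hX u)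
    (fun u _ => by simpa using (hasDerivAt_id' u).const_mul ε)
    (fun u _ => by
      have ha := RotorKnob.traj_sq_le_one hX h0 u 0
      have h1 : ε * X u 0 ^ 2 ≤ ε * 1 := mul_le_mul_of_nonneg_left ha hε
      have h2 : 0 ≤ ε⁻¹ * M * X u 2 ^ 2 :=
        mul_nonneg (mul_nonneg (inv_nonneg.2 hε) hM) (sq_nonneg _)
      show ε * X u 0 ^ 2 - ε⁻¹ * M * X u 2 ^ 2 ≤ ε
      linarith only [h1, h2])
  have h := hanti (left_mem_Icc.2 hst) (right_mem_Icc.2 hst) hst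
  dsimp only at h
  have e : ε * (t - s) = ε * t - ε * s := by ring
  linarith only [h, e]

/-! ## §221 The climb: exponential growth of the trigger while the clock is charged -/

/-- §221 (any member, `ε > 0`, `M ≥ 0`): if `b ≥ β` and `c > 0` on `[s, t]` then
`log c(s) + ε⁻¹Mβ(t - s) ≤ log c(t)` (`(log c)' = (ρ²e^{-M}a² + ε⁻¹Mbc)/c ≥ ε⁻¹Mβ`).
[cite: Tao2016AveragedNS, §5.5 (c-eq)] -/
theorem clock_rise_exp (hX : ∀ t, HasDerivAt X (RotorKnob.rotorCircuit K M ε ρ (X t)) t)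
    (hε : 0 < ε) (hM : 0 ≤ M) {s t β : ℝ} (hst : s ≤ t) (hb : ∀ u ∈ Icc s t, β ≤ X u 1)
    (hc : ∀ u ∈ Icc s t, 0 < X u 2) :
    log (X s 2) + ε⁻¹ * M * β * (t - s) ≤ log (X t 2) := by
  have hmono := Thm53.monotoneOn_sub_of_le_deriv (f := fun u => log (X u 2))
    (f' := fun u => (ρ ^ 2 * exp (-M) * X u 0 ^ 2 + ε⁻¹ * M * X u 1 * X u 2) / X u 2)
    (Φ := fun u => ε⁻¹ * M * β * u) (φ := fun _ => ε⁻¹ * M * β) (convex_Icc s t)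
    (fun u hu => (RotorKnob.hasDerivAt_c hX u).log (hc u hu).ne')
    (fun u _ => by simpa using (hasDerivAt_id' u).const_mul (ε⁻¹ * M * β))
    (fun u hu => by
      have hcu := hc u hu
      show ε⁻¹ * M * β ≤ (ρ ^ 2 * exp (-M) * X u 0 ^ 2 + ε⁻¹ * M * X u 1 * X u 2) / X u 2
      rw [le_div_iff₀ hcu]
      have h1 : 0 ≤ ρ ^ 2 * exp (-M) * X u 0 ^ 2 := by positivity
      have hμc : 0 ≤ ε⁻¹ * M * X u 2 := by positivity
      have h2 : ε⁻¹ * M * X u 2 * β ≤ ε⁻¹ * M * X u 2 * X u 1 :=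
        mul_le_mul_of_nonneg_left (hb u hu) hμc
      nlinarith only [h1, h2])
  have h := hmono (left_mem_Icc.2 hst) (right_mem_Icc.2 hst) hst
  dsimp only at h
  have e : ε⁻¹ * M * β * (t - s) = ε⁻¹ * M * β * t - ε⁻¹ * M * β * s := by ring
  linarith only [h, e]

/-! ## §222 The band law: the pump is logistic on the ring -/

/-- §222 THE BAND LAW (any member from `delayInit`, `ε, M > 0`). On `[s, t]` let
`Q ≤ b² + c²` (a kept ring from below) and `R₂ > 0` with `R₂² + ε²/M ≤ Q`, and suppose
`b² < R₂²` on `[s, t]`. Then `b' = εa² - ε⁻¹Mc² ≤ -ε⁻¹M(R₂² - b²)` and the log-ratio obeys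
`log(R₂ + b(t)) - log(R₂ - b(t)) + 2ε⁻¹MR₂(t - s) ≤ log(R₂ + b(s)) - log(R₂ - b(s))`:
the clock crosses the band no slower than the `tanh` profile of speed `ε⁻¹MR₂`.
[cite: Tao2016AveragedNS, §5.5 (b-eq), (energy-con), (tcable)] -/
theorem clock_band_ratio (hX : ∀ t, HasDerivAt X (RotorKnob.rotorCircuit K M ε ρ (X t)) t)
    (h0 : X 0 = delayInit) (hε : 0 < ε) (hM : 0 < M) {s t R₂ Q : ℝ} (hst : s ≤ t)
    (hR : 0 < R₂) (hQ : R₂ ^ 2 + ε ^ 2 / M ≤ Q)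
    (hring : ∀ u ∈ Icc s t, Q ≤ X u 1 ^ 2 + X u 2 ^ 2)
    (hband : ∀ u ∈ Icc s t, X u 1 ^ 2 < R₂ ^ 2) :
    log (R₂ + X t 1) - log (R₂ - X t 1) + 2 * (ε⁻¹ * M) * R₂ * (t - s)
      ≤ log (R₂ + X s 1) - log (R₂ - X s 1) := by
  have hμ : 0 < ε⁻¹ * M := by positivity
  have hsides : ∀ u ∈ Icc s t, 0 < R₂ + X u 1 ∧ 0 < R₂ - X u 1 := by
    intro u hu
    obtain ⟨h1, h2⟩ := abs_lt_of_sq_lt_sq' (hband u hu) hR.le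
    exact ⟨by linarith only [h1], by linarith only [h2]⟩
  have hanti := Thm53.antitoneOn_sub_of_deriv_le
    (f := fun u => log (R₂ + X u 1) - log (R₂ - X u 1))
    (f' := fun u => (0 + (ε * X u 0 ^ 2 - ε⁻¹ * M * X u 2 ^ 2)) / (R₂ + X u 1)
      - (0 - (ε * X u 0 ^ 2 - ε⁻¹ * M * X u 2 ^ 2)) / (R₂ - X u 1))
    (Φ := fun u => -(2 * (ε⁻¹ * M) * R₂) * u) (φ := fun _ => -(2 * (ε⁻¹ * M) * R₂))
    (convex_Icc s t)
    (fun u hu => by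
      obtain ⟨h1, h2⟩ := hsides u hu
      exact (((hasDerivAt_const u R₂).add (RotorKnob.hasDerivAt_b hX u)).log h1.ne').sub
        (((hasDerivAt_const u R₂).sub (RotorKnob.hasDerivAt_b hX u)).log h2.ne'))
    (fun u _ => by simpa using (hasDerivAt_id' u).const_mul (-(2 * (ε⁻¹ * M) * R₂)))
    (fun u hu => by
      obtain ⟨h1, h2⟩ := hsides u hu
      obtain ⟨b', hb'⟩ : ∃ b' : ℝ, b' = ε * X u 0 ^ 2 - ε⁻¹ * M * X u 2 ^ 2 := ⟨_, rfl⟩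
      -- the logistic inequality `b' ≤ -μ(R₂² - b²)`
      have key : b' ≤ -(ε⁻¹ * M) * (R₂ ^ 2 - X u 1 ^ 2) := by
        have ha := RotorKnob.traj_sq_le_one hX h0 u 0
        have hc2 : R₂ ^ 2 + ε ^ 2 / M - X u 1 ^ 2 ≤ X u 2 ^ 2 := by
          linarith only [hring u hu, hQ]
        have e1 : ε⁻¹ * M * (ε ^ 2 / M) = ε := by
          field_simp
        have h3 := mul_le_mul_of_nonneg_left hc2 hμ.le
        have h4 : ε * X u 0 ^ 2 ≤ ε * 1 := mul_le_mul_of_nonneg_left ha hε.le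
        rw [hb']
        nlinarith only [h3, h4, e1]
      have h12 : 0 < (R₂ + X u 1) * (R₂ - X u 1) := mul_pos h1 h2
      show (0 + (ε * X u 0 ^ 2 - ε⁻¹ * M * X u 2 ^ 2)) / (R₂ + X u 1)
          - (0 - (ε * X u 0 ^ 2 - ε⁻¹ * M * X u 2 ^ 2)) / (R₂ - X u 1)
        ≤ -(2 * (ε⁻¹ * M) * R₂)
      rw [← hb']
      have e2 : (0 + b') / (R₂ + X u 1) - (0 - b') / (R₂ - X u 1)
          = 2 * R₂ * b' / ((R₂ + X u 1) * (R₂ - X u 1)) := by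
        rw [zero_add, zero_sub, neg_div, sub_neg_eq_add, div_add_div _ _ h1.ne' h2.ne']
        congr 1
        ring
      rw [e2, div_le_iff₀ h12]
      have h5 := mul_le_mul_of_nonneg_left key (by positivity : (0 : ℝ) ≤ 2 * R₂)
      have e3 : 2 * R₂ * (-(ε⁻¹ * M) * (R₂ ^ 2 - X u 1 ^ 2))
          = -(2 * (ε⁻¹ * M) * R₂) * ((R₂ + X u 1) * (R₂ - X u 1)) := by ring
      linarith only [h5, e3])
  have h := hanti (left_mem_Icc.2 hst) (right_mem_Icc.2 hst) hst
  dsimp only at h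
  have e : -(2 * (ε⁻¹ * M) * R₂) * t = -(2 * (ε⁻¹ * M) * R₂) * s
      - 2 * (ε⁻¹ * M) * R₂ * (t - s) := by ring
  linarith only [h, e]

/-! ## §223 The phase decomposition of a headline pulse -/

/-- §223 THE PHASE DECOMPOSITION (headline member `M = K¹⁰`, `K ≥ 16`, `ε, ρ > 0`,
`K¹⁰ρ² ≤ 2ε`). A pulse `[r, T']` (`T' - r ≤ 242/K⁹`) entered at `b(r) = θε`, `c(r) = ρ²/K⁹`
(`θ ≥ 5/4`), with the kept ring `|b² + c² - (b(r)² + c(r)²)| ≤ 10⁻⁶ε²` and `c > 0` on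
`[r, T']`, and left with `b(T') ≤ -(31/32)θε` (part 61/65: `b(T') = -θ'ε`,
`θ' ≥ θ - 243/K⁹`), splits at band times `r < t₁ < t₂ ≤ T'`: CLIMB `b ≥ (31/32)θε` on
`[r, t₁]`, lasting `≤ 32(log c(t₁) - log c(r))/(31θK¹⁰)`; SWING `t₂ - t₁ ≤ 4.16/(θK¹⁰)`;
FALL `b ≤ -(15/16)θε` on `[t₂, T']`; and `c(t₁)², c(t₂)² ≤ θ²ε²/16` at the band edges.
[derived: this file §220–§222; Literature `Thm53.exists_hitTime`] -/
theorem pulse_clock_phases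
    (hX : ∀ t, HasDerivAt X (RotorKnob.rotorCircuit K (K ^ 10) ε ρ (X t)) t)
    (h0 : X 0 = delayInit) (hK : 16 ≤ K) (hε : 0 < ε) (hρ : 0 < ρ)
    (hhi : K ^ 10 * ρ ^ 2 ≤ 2 * ε) {r T' θ : ℝ} (hrT : r ≤ T') (hτ : T' - r ≤ 242 / K ^ 9)
    (hθ1 : 5 / 4 ≤ θ) (hbr : X r 1 = θ * ε) (hcr : X r 2 = ρ ^ 2 / K ^ 9)
    (hkept : ∀ t ∈ Icc r T', |X t 1 ^ 2 + X t 2 ^ 2 - (X r 1 ^ 2 + X r 2 ^ 2)| ≤ ε ^ 2 / 10 ^ 6)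
    (hpos : ∀ t ∈ Icc r T', 0 < X t 2) (hbT : X T' 1 ≤ -(31 / 32 * θ * ε)) :
    ∃ t₁ t₂ : ℝ, r < t₁ ∧ t₁ < t₂ ∧ t₂ ≤ T' ∧
      (∀ t ∈ Icc r t₁, 31 / 32 * θ * ε ≤ X t 1) ∧ X t₁ 2 ^ 2 ≤ θ ^ 2 * ε ^ 2 / 16 ∧
      t₁ - r ≤ 32 * (log (X t₁ 2) - log (X r 2)) / (31 * θ * K ^ 10) ∧
      t₂ - t₁ ≤ 4.16 / (θ * K ^ 10) ∧ X t₂ 2 ^ 2 ≤ θ ^ 2 * ε ^ 2 / 16 ∧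
      (∀ t ∈ Icc t₂ T', X t 1 ≤ -(15 / 16 * θ * ε)) := by
  have hK0 : (0 : ℝ) < K := by linarith
  have hK1 : (1 : ℝ) ≤ K := by linarith
  have hθ0 : 0 < θ := by linarith
  have hθε : 0 < θ * ε := mul_pos hθ0 hε
  have hθε2 : 25 / 16 * ε ^ 2 ≤ (θ * ε) ^ 2 := by
    nlinarith only [mul_le_mul_of_nonneg_right hθ1 hε.le, hε]
  obtain ⟨b₁, hb₁⟩ : ∃ b₁ : ℝ, b₁ = 31 / 32 * θ * ε := ⟨_, rfl⟩
  have hb₁0 : 0 < b₁ := by rw [hb₁]; positivity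
  have hcont : Continuous fun s => X s 1 := RotorKnob.continuous_traj hX 1
  -- numerics: `K⁹ ≥ 2³⁶`, so `242ε/K⁹ ≤ θε/10⁴` and `ρ²/K⁹ ≤ ε/10³`
  have hK9 : (2 : ℝ) ^ 36 ≤ K ^ 9 := by
    calc (2 : ℝ) ^ 36 = 16 ^ 9 := by norm_num
      _ ≤ K ^ 9 := pow_le_pow_left₀ (by norm_num) hK 9
  have hK9pos : (0 : ℝ) < K ^ 9 := by positivity
  have hK10 : (2 : ℝ) ^ 40 ≤ K ^ 10 := by
    calc (2 : ℝ) ^ 40 = 16 ^ 10 := by norm_num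
      _ ≤ K ^ 10 := pow_le_pow_left₀ (by norm_num) hK 10
  have hK10pos : (0 : ℝ) < K ^ 10 := by positivity
  have hτε : ε * (T' - r) ≤ θ * ε / 10 ^ 4 := by
    have e1 : ε * (T' - r) ≤ ε * (242 / K ^ 9) := mul_le_mul_of_nonneg_left hτ hε.le
    have e2 : 242 / K ^ 9 ≤ 242 / 2 ^ 36 :=
      div_le_div_of_nonneg_left (by norm_num) (by positivity) hK9
    have e3 : ε * (242 / 2 ^ 36) ≤ θ * ε / 10 ^ 4 := by
      rw [le_div_iff₀ (by norm_num : (0 : ℝ) < 10 ^ 4)]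
      nlinarith only [hε, hθ1]
    nlinarith only [e1, e2, e3, hε]
  have hcr1 : ρ ^ 2 / K ^ 9 ≤ ε / 10 ^ 3 := by
    have hρε : ρ ^ 2 ≤ 2 * ε / K ^ 10 := by
      rw [le_div_iff₀ hK10pos]
      linarith only [hhi]
    have e1 : ρ ^ 2 / K ^ 9 ≤ ρ ^ 2 := div_le_self (by positivity) (one_le_pow₀ hK1)
    have e3 : 2 * ε / K ^ 10 ≤ 2 * ε / 2 ^ 40 :=
      div_le_div_of_nonneg_left (by positivity) (by positivity) hK10
    have e4 : 2 * ε / 2 ^ 40 ≤ ε / 10 ^ 3 := by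
      rw [div_le_div_iff₀ (by positivity) (by positivity)]
      linarith only [hε]
    linarith only [e1, hρε, e3, e4]
  have hcr2 : X r 2 ^ 2 ≤ ε ^ 2 / 10 ^ 6 := by
    rw [hcr]
    calc (ρ ^ 2 / K ^ 9) ^ 2 ≤ (ε / 10 ^ 3) ^ 2 := pow_le_pow_left₀ (by positivity) hcr1 2
      _ = ε ^ 2 / 10 ^ 6 := by rw [div_pow]; norm_num
  -- the ring from above and below
  have hring : ∀ t ∈ Icc r T', θ ^ 2 * ε ^ 2 - ε ^ 2 / 10 ^ 6 ≤ X t 1 ^ 2 + X t 2 ^ 2 ∧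
      X t 1 ^ 2 + X t 2 ^ 2 ≤ θ ^ 2 * ε ^ 2 + 2 * ε ^ 2 / 10 ^ 6 := by
    intro t ht
    have h := abs_le.1 (hkept t ht)
    rw [hbr] at h
    constructor
    · nlinarith only [h.1, sq_nonneg (X r 2)]
    · nlinarith only [h.2, hcr2]
  -- trigger at a band edge: `b² ≥ b₁²` ⇒ `c² ≤ θ²ε²/16`
  have hedge : ∀ t ∈ Icc r T', b₁ ^ 2 ≤ X t 1 ^ 2 → X t 2 ^ 2 ≤ θ ^ 2 * ε ^ 2 / 16 := by
    intro t ht hb2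
    have h := (hring t ht).2
    rw [hb₁] at hb2
    nlinarith only [h, hb2, hθε2]
  -- `r < T'`
  have hrT' : r < T' := by
    rcases hrT.lt_or_eq with h | h
    · exact h
    · exfalso
      rw [← h, hbr] at hbT
      nlinarith only [hbT, hθε]
  -- (1) the first band time `t₁`: first hit of `b = b₁` from above
  obtain ⟨τ₁, hτ₁0, hτ₁T, hge₁, hhit₁⟩ := Thm53.exists_hitTime (u := fun s => -X (r + s) 1)
    (θ := -b₁) (T := T' - r) ((hcont.comp (continuous_const.add continuous_id)).neg)
    (by linarith only [hrT']) (by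
      show -X (r + 0) 1 < -b₁
      rw [add_zero, hbr, hb₁]; nlinarith only [hθε])
  have hτ₁lt : τ₁ < T' - r := by
    rcases hτ₁T.lt_or_eq with h | h
    · exact h
    · exfalso
      have := hge₁ τ₁ hτ₁0.le le_rfl
      rw [h, show r + (T' - r) = T' by ring] at this
      rw [hb₁] at this
      nlinarith only [this, hbT, hθε]
  have hbt₁ : X (r + τ₁) 1 = b₁ := by
    have := hhit₁ hτ₁lt
    linarith only [this]
  set t₁ := r + τ₁ with ht₁
  have hrt₁ : r < t₁ := by rw [ht₁]; linarith only [hτ₁0]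
  have ht₁T : t₁ < T' := by rw [ht₁]; linarith only [hτ₁lt]
  have hclimb : ∀ t ∈ Icc r t₁, b₁ ≤ X t 1 := by
    intro t ht
    have := hge₁ (t - r) (by linarith only [ht.1]) (by rw [ht₁] at ht; linarith only [ht.2])
    simp only [add_sub_cancel] at this
    linarith only [this]
  -- (2) the second band time `t₂`: first hit of `b = -b₁` after `t₁`
  obtain ⟨τ₂, hτ₂0, hτ₂T, hge₂, hhit₂⟩ := Thm53.exists_hitTime (u := fun s => -X (t₁ + s) 1)
    (θ := b₁) (T := T' - t₁) ((hcont.comp (continuous_const.add continuous_id)).neg)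
    (by linarith only [ht₁T]) (by
      show -X (t₁ + 0) 1 < b₁
      rw [add_zero, hbt₁]; linarith only [hb₁0])
  set t₂ := t₁ + τ₂ with ht₂
  have ht₁t₂ : t₁ < t₂ := by rw [ht₂]; linarith only [hτ₂0]
  have ht₂T : t₂ ≤ T' := by rw [ht₂]; linarith only [hτ₂T]
  have hlow₂ : ∀ t ∈ Icc t₁ t₂, -b₁ ≤ X t 1 := by
    intro t ht
    have := hge₂ (t - t₁) (by linarith only [ht.1]) (by rw [ht₂] at ht; linarith only [ht.2])
    simp only [add_sub_cancel] at this
    linarith only [this]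
  have hbt₂ : X t₂ 1 = -b₁ := by
    rcases hτ₂T.lt_or_eq with h | h
    · have := hhit₂ h
      rw [ht₂]; linarith only [this]
    · have e : t₂ = T' := by rw [ht₂, h]; ring
      have h1 := hlow₂ t₂ ⟨ht₁t₂.le, le_rfl⟩
      rw [e] at h1 ⊢
      rw [hb₁] at h1 ⊢
      linarith only [h1, hbT]
  -- (3) the clock above: charging at rate `≤ ε` after `t₁` and after `t₂`
  have hup₁ : ∀ t ∈ Icc t₁ T', X t 1 ≤ b₁ + θ * ε / 10 ^ 4 := by
    intro t ht
    have h := clock_charge_le hX h0 hε.le (by positivity) ht.1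
    rw [hbt₁] at h
    have : ε * (t - t₁) ≤ ε * (T' - r) :=
      mul_le_mul_of_nonneg_left (by linarith only [ht.2, hrt₁]) hε.le
    linarith only [h, this, hτε]
  have hfall : ∀ t ∈ Icc t₂ T', X t 1 ≤ -(15 / 16 * θ * ε) := by
    intro t ht
    have h := clock_charge_le hX h0 hε.le (by positivity) ht.1
    rw [hbt₂, hb₁] at h
    have : ε * (t - t₂) ≤ ε * (T' - r) :=
      mul_le_mul_of_nonneg_left (by linarith only [ht.2, ht₁t₂, hrt₁]) hε.le
    nlinarith only [h, this, hτε, hθε]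
  -- (4) the swing: the band law on `[t₁, t₂]` with `R₂ = (1 - 10⁻⁶)θε`
  obtain ⟨R₂, hR₂⟩ : ∃ R₂ : ℝ, R₂ = (1 - 1 / 10 ^ 6) * (θ * ε) := ⟨_, rfl⟩
  have hR₂0 : 0 < R₂ := by rw [hR₂]; positivity
  have hQ : R₂ ^ 2 + ε ^ 2 / K ^ 10 ≤ θ ^ 2 * ε ^ 2 - ε ^ 2 / 10 ^ 6 := by
    have e1 : ε ^ 2 / K ^ 10 ≤ ε ^ 2 / 2 ^ 40 :=
      div_le_div_of_nonneg_left (by positivity) (by positivity) hK10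
    rw [hR₂]
    nlinarith only [e1, hθε2, sq_nonneg ε]
  have hband : ∀ u ∈ Icc t₁ t₂, X u 1 ^ 2 < R₂ ^ 2 := by
    intro u hu
    have h1 := hlow₂ u hu
    have h2 := hup₁ u ⟨hu.1, hu.2.trans ht₂T⟩
    have hlt1 : -R₂ < X u 1 := by rw [hR₂]; rw [hb₁] at h1; nlinarith only [h1, hθε]
    have hlt2 : X u 1 < R₂ := by rw [hR₂]; rw [hb₁] at h2; nlinarith only [h2, hθε]
    exact sq_lt_sq' hlt1 hlt2
  have hratio := clock_band_ratio hX h0 hε hK10pos ht₁t₂.le hR₂0 hQ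
    (fun u hu => (hring u ⟨hrt₁.le.trans hu.1, hu.2.trans ht₂T⟩).1) hband
  rw [hbt₁, hbt₂, sub_neg_eq_add, ← sub_eq_add_neg] at hratio
  -- the band ratio `(R₂ + b₁)/(R₂ - b₁) ≤ 64`, so the crossing takes `≤ 6 log 2/(μR₂)`
  have hRb1 : 0 < R₂ - b₁ := by rw [hR₂, hb₁]; nlinarith only [hθε]
  have hRb2 : 0 < R₂ + b₁ := by linarith only [hR₂0, hb₁0]
  have h64 : R₂ + b₁ ≤ 2 ^ 6 * (R₂ - b₁) := by rw [hR₂, hb₁]; nlinarith only [hθε]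
  have hlog : log (R₂ + b₁) - log (R₂ - b₁) ≤ 6 * log 2 := by
    have h1 := log_le_log hRb2 h64
    rw [log_mul (by norm_num) hRb1.ne', log_pow] at h1
    push_cast at h1
    linarith only [h1]
  have hl2 := Real.log_two_lt_d9
  have hswing : t₂ - t₁ ≤ 4.16 / (θ * K ^ 10) := by
    -- `2μR₂(t₂ - t₁) ≤ 2(log(R₂ + b₁) - log(R₂ - b₁)) ≤ 12 log 2`
    have h1 : 2 * (ε⁻¹ * K ^ 10) * R₂ * (t₂ - t₁) ≤ 12 * log 2 := by
      linarith only [hratio, hlog]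
    have hμR : 0 < 2 * (ε⁻¹ * K ^ 10) * R₂ := by positivity
    rw [le_div_iff₀ (by positivity)]
    have e : 2 * (ε⁻¹ * K ^ 10) * R₂ = 2 * (1 - 1 / 10 ^ 6) * θ * K ^ 10 := by
      rw [hR₂]; field_simp
    rw [e] at h1
    nlinarith only [h1, hl2, hθ0, hK10pos, ht₁t₂]
  -- (5) the climb duration from §221 with `β = b₁`
  have hclimbτ : t₁ - r ≤ 32 * (log (X t₁ 2) - log (X r 2)) / (31 * θ * K ^ 10) := by
    have h := clock_rise_exp hX hε (by positivity) hrt₁.le hclimb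
      (fun u hu => hpos u ⟨hu.1, hu.2.trans ht₁T.le⟩)
    rw [le_div_iff₀ (by positivity)]
    have e : ε⁻¹ * K ^ 10 * b₁ = 31 / 32 * θ * K ^ 10 := by
      rw [hb₁]; field_simp
    rw [e] at h
    nlinarith only [h, hθ0, hK10pos]
  refine ⟨t₁, t₂, hrt₁, ht₁t₂, ht₂T, ?_, ?_, hclimbτ, hswing, ?_, hfall⟩
  · intro t ht; rw [← hb₁]; exact hclimb t ht
  · exact hedge t₁ ⟨hrt₁.le, ht₁T.le⟩ (by rw [hbt₁])
  · exact hedge t₂ ⟨hrt₁.le.trans ht₁t₂.le, ht₂T⟩ (by rw [hbt₂, neg_sq])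

end Summit.NavierStokesRegularity.FluidComputer.GateBudget
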